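import Summits.RiemannHypothesis.RiemannHypothesis.Theorems.LeeYangLeeyangThesisStubStepApproxAux
import Literature.Analysis.InverseSpectral.KreinStringProofs
import Literature.Analysis.InverseSpectral.KreinStringPositivity
import Literature.Analysis.InverseSpectral.KreinStringWeylContinuity
import HarnessLib

/-!
# Lower step approximation of a monotone-density Kreĭn string, part 2: the stub

Stub `stub_stepApprox` of the line `Sketch` (card `telegraph-string`) for the crux
`Summit.RiemannHypothesis.RiemannHypothesis.Theses.LeeYang.LeeyangThesis`
(item stmt-RiemannHypothesis-0451).

If a Kreĭn string `S` of finite length `L` has mass `ρ(y) dy` on `(-∞, L)` with `ρ` measurable,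
non-decreasing on `(-∞, L)` and zero on `(-∞, 0)`, then for every interior point `x`, every
`ε > 0` and every radius `R` there are step data `0 ≤ s₀ < … < s_{N-1} ≤ x`, `d_j > 0`, such that
every string `T` of infinite length with density `Σ_j d_j 𝟙[s_j ≤ ·]` carries no more mass than
`S` on `(-∞, x]` and `‖φ_T(x, z) - φ_S(x, z)‖ ≤ ε` for `‖z‖ ≤ R`.

## Proof

* Step data with `g ≤ ρ` on `(-∞, x]` and `∫_{(-∞,x]} (ρ - g) ≤ δ`, and the decomposition
  `μ_S|(-∞,x] = μ_T|(-∞,x] + (ρ - g) dy|(-∞,x]` (hence domination and `|m_T - m_S| ≤ δ` on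
  `[0, x]`) are in part 1 (`…StubStepApproxAux`).
* (`stepApprox_picard_le`, `stepApprox_norm_phi_sub_le`) Domination of the mass on `(-∞, x]` gives
  termwise domination of the Picard series, `0 ≤ φ_{T,n} ≤ φ_{S,n}` on `[0, x]`, whence
  `‖φ_T(x,z) - φ_S(x,z)‖ ≤ Σ_n Rⁿ (φ_{S,n}(x) - φ_{T,n}(x)) = φ_S(x,-R) - φ_T(x,-R)` for `‖z‖ ≤ R`.
* (`stepApprox_phi_neg_sub_le`) The real difference is bounded by the tree's comparison theorem
  `KreinString.norm_phi_neg_sub_le` with the error term `KreinString.norm_setIntegral_phi_sub_le`,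
  both linear in `sup_{[0,x]} |m_T - m_S| ≤ δ`; choosing `δ = ε / (K + 1)` with the explicit
  constant `K = K(R, x, φ_S(x, -max R 1), m_S(x))` finishes the proof.
-/

noncomputable section

-- single-problem summit namespace `Summit.RiemannHypothesis.RiemannHypothesis.…` (D-0017)
set_option linter.dupNamespace false

open MeasureTheory Filter Topology Complex Set
open scoped ENNReal
open Literature.Analysis.InverseSpectral

namespace Summit.RiemannHypothesis.RiemannHypothesis.Theorems.LeeYangTelegraphString

/-! ### Termwise domination of the Picard series -/

/-- If `T` carries no more mass than `S` on `(-∞, x]` (`x` inside both strings), the Picard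
iterates `φₙ = Kⁿ 1` satisfy `φ_{T,n} ≤ φ_{S,n}` on `[0, x]`. -/
theorem stepApprox_picard_le (S T : KreinString) {x : ℝ} (hx : x ∈ S.dom) (hxT : x ∈ T.dom)
    (hdom : T.massMeasure.restrict (Set.Iic x) ≤ S.massMeasure.restrict (Set.Iic x)) (n : ℕ) :
    ∀ t ∈ Set.Icc 0 x, T.picard (fun _ => (1 : ℝ)) n t ≤ S.picard (fun _ => (1 : ℝ)) n t := by
  induction n with
  | zero => intro t _; simp
  | succ n ih =>
    intro t ht
    rw [KreinString.picard_succ, KreinString.picard_succ]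
    have htS : t ∈ S.dom := S.Icc_subset_dom hx ht
    have htT : t ∈ T.dom := T.Icc_subset_dom hxT ht
    have hsub : Set.Icc 0 t ⊆ Set.Icc 0 x := Set.Icc_subset_Icc_right ht.2
    have hcS : ContinuousOn (fun u => (t - u) * S.picard (fun _ => (1 : ℝ)) n u) (Set.Icc 0 t) :=
      (continuousOn_const.sub continuousOn_id).mul
        ((S.continuousOn_picard hx continuousOn_const n).mono hsub)
    have hcT : ContinuousOn (fun u => (t - u) * T.picard (fun _ => (1 : ℝ)) n u) (Set.Icc 0 t) :=
      (continuousOn_const.sub continuousOn_id).mul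
        ((T.continuousOn_picard hxT continuousOn_const n).mono hsub)
    have hIcc : Set.Icc 0 t ⊆ Set.Iic x := fun u hu => hu.2.trans ht.2
    have hle : T.massMeasure.restrict (Set.Icc 0 t) ≤ S.massMeasure.restrict (Set.Icc 0 t) := by
      calc T.massMeasure.restrict (Set.Icc 0 t)
          = (T.massMeasure.restrict (Set.Iic x)).restrict (Set.Icc 0 t) := by
            rw [Measure.restrict_restrict measurableSet_Icc, Set.inter_eq_left.2 hIcc]
        _ ≤ (S.massMeasure.restrict (Set.Iic x)).restrict (Set.Icc 0 t) :=
            Measure.restrict_mono subset_rfl hdom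
        _ = S.massMeasure.restrict (Set.Icc 0 t) := by
            rw [Measure.restrict_restrict measurableSet_Icc, Set.inter_eq_left.2 hIcc]
    calc ∫ u in Set.Icc 0 t, (t - u) * T.picard (fun _ => (1 : ℝ)) n u ∂T.massMeasure
        ≤ ∫ u in Set.Icc 0 t, (t - u) * S.picard (fun _ => (1 : ℝ)) n u ∂T.massMeasure :=
          setIntegral_mono_on (T.integrableOn_Icc_of_continuousOn htT hcT)
            (KreinString.integrableOn_Icc_of_continuousOn_of_ne_top
              (T.massMeasure_Icc_lt_top htT).ne hcS)
            measurableSet_Icc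
            (fun u hu => mul_le_mul_of_nonneg_left (ih u (hsub hu)) (sub_nonneg.2 hu.2))
      _ ≤ ∫ u in Set.Icc 0 t, (t - u) * S.picard (fun _ => (1 : ℝ)) n u ∂S.massMeasure :=
          integral_mono_measure hle
            (ae_restrict_of_forall_mem measurableSet_Icc fun u hu =>
              mul_nonneg (sub_nonneg.2 hu.2) (S.picard_nonneg (fun _ _ => zero_le_one) n hu.1))
            (S.integrableOn_Icc_of_continuousOn htS hcS)

/-- **From complex `z` to the negative axis.** If `T` carries no more mass than `S` on `(-∞, x]`,
then for `‖z‖ ≤ R`, `‖φ_T(x, z) - φ_S(x, z)‖ ≤ φ_S(x, -R) - φ_T(x, -R)` (termwise domination of the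
Picard series). -/
theorem stepApprox_norm_phi_sub_le (S T : KreinString) {x : ℝ} (hx : x ∈ S.dom) (hxT : x ∈ T.dom)
    (hdom : T.massMeasure.restrict (Set.Iic x) ≤ S.massMeasure.restrict (Set.Iic x))
    {R : ℝ} (z : ℂ) (hz : ‖z‖ ≤ R) :
    ‖T.phi z x - S.phi z x‖ ≤ (S.phi (-(R : ℂ)) x).re - (T.phi (-(R : ℂ)) x).re := by
  have hle : ∀ n, T.picard (fun _ => (1 : ℝ)) n x ≤ S.picard (fun _ => (1 : ℝ)) n x := fun n =>
    stepApprox_picard_le S T hx hxT hdom n x ⟨hx.1, le_rfl⟩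
  have hsumS := S.summable_picard_term continuous_const z hx (f := fun _ => (1 : ℝ))
  have hsumT := T.summable_picard_term continuous_const z hxT (f := fun _ => (1 : ℝ))
  have hRS := S.summable_picard_neg continuous_const R hx (f := fun _ => (1 : ℝ))
  have hRT := T.summable_picard_neg continuous_const R hxT (f := fun _ => (1 : ℝ))
  have hnorm : ∀ n, ‖(-z) ^ n * (T.picard (fun _ => (1 : ℝ)) n x : ℂ) -
      (-z) ^ n * (S.picard (fun _ => (1 : ℝ)) n x : ℂ)‖ =
      ‖z‖ ^ n * (S.picard (fun _ => (1 : ℝ)) n x - T.picard (fun _ => (1 : ℝ)) n x) := by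
    intro n
    rw [← mul_sub, norm_mul, norm_pow, norm_neg, ← Complex.ofReal_sub, Complex.norm_real,
      Real.norm_eq_abs, abs_sub_comm, abs_of_nonneg (sub_nonneg.2 (hle n))]
  have hbound : ∀ n, ‖z‖ ^ n * (S.picard (fun _ => (1 : ℝ)) n x - T.picard (fun _ => (1 : ℝ)) n x)
      ≤ R ^ n * (S.picard (fun _ => (1 : ℝ)) n x - T.picard (fun _ => (1 : ℝ)) n x) := fun n =>
    mul_le_mul_of_nonneg_right (pow_le_pow_left₀ (norm_nonneg _) hz n) (sub_nonneg.2 (hle n))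
  have hRdiff : Summable (fun n => R ^ n *
      (S.picard (fun _ => (1 : ℝ)) n x - T.picard (fun _ => (1 : ℝ)) n x)) :=
    (hRS.sub hRT).congr (fun n => by ring)
  have hzdiff : Summable (fun n => ‖z‖ ^ n *
      (S.picard (fun _ => (1 : ℝ)) n x - T.picard (fun _ => (1 : ℝ)) n x)) :=
    Summable.of_nonneg_of_le
      (fun n => mul_nonneg (pow_nonneg (norm_nonneg _) n) (sub_nonneg.2 (hle n))) hbound hRdiff
  calc ‖T.phi z x - S.phi z x‖
      = ‖∑' n, ((-z) ^ n * (T.picard (fun _ => (1 : ℝ)) n x : ℂ) -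
          (-z) ^ n * (S.picard (fun _ => (1 : ℝ)) n x : ℂ))‖ := by
        rw [hsumT.tsum_sub hsumS]
        rfl
    _ ≤ ∑' n, ‖(-z) ^ n * (T.picard (fun _ => (1 : ℝ)) n x : ℂ) -
          (-z) ^ n * (S.picard (fun _ => (1 : ℝ)) n x : ℂ)‖ :=
        norm_tsum_le_tsum_norm (hzdiff.congr (fun n => (hnorm n).symm))
    _ = ∑' n, ‖z‖ ^ n * (S.picard (fun _ => (1 : ℝ)) n x - T.picard (fun _ => (1 : ℝ)) n x) :=
        tsum_congr hnorm
    _ ≤ ∑' n, R ^ n * (S.picard (fun _ => (1 : ℝ)) n x - T.picard (fun _ => (1 : ℝ)) n x) :=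
        hzdiff.tsum_le_tsum hbound hRdiff
    _ = ∑' n, R ^ n * S.picard (fun _ => (1 : ℝ)) n x -
          ∑' n, R ^ n * T.picard (fun _ => (1 : ℝ)) n x := by
        rw [← hRS.tsum_sub hRT]
        exact tsum_congr (fun n => by ring)
    _ = (S.phi (-(R : ℂ)) x).re - (T.phi (-(R : ℂ)) x).re := by
        rw [S.phi_neg_re, T.phi_neg_re]

/-! ### The comparison on the negative axis -/

/-- **Comparison of `φ(x, -s)` for two strings with close mass functions**: if
`|m_T - m_S| ≤ δ` on `[0, x]` then
`‖φ_T(x,-s) - φ_S(x,-s)‖ ≤ s x (C δ + s C m_S(x) δ x) φ_T(x,-s)`, `C = φ_S(x,-s)`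
(`KreinString.norm_phi_neg_sub_le` with the error bound
`KreinString.norm_setIntegral_phi_sub_le`). -/
theorem stepApprox_phi_neg_sub_le (S T : KreinString) {s : ℝ} (hs : 0 < s) {x : ℝ} (hx : x ∈ S.dom)
    (hxT : x ∈ T.dom) {δ : ℝ} (hmass : ∀ v ∈ Set.Icc 0 x, |T.mass v - S.mass v| ≤ δ) :
    ‖T.phi (-(s : ℂ)) x - S.phi (-(s : ℂ)) x‖ ≤
      s * (((S.phi (-(s : ℂ)) x).re * δ +
        s * ((S.phi (-(s : ℂ)) x).re * S.mass x) * (δ * x)) * x) * (T.phi (-(s : ℂ)) x).re := by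
  have hC0 : 0 ≤ (S.phi (-(s : ℂ)) x).re := zero_le_one.trans (S.one_le_phi_neg_re hs.le hx)
  have hT0 : 0 ≤ (T.phi (-(s : ℂ)) x).re := zero_le_one.trans (T.one_le_phi_neg_re hs.le hxT)
  have hvol : (volume : Measure ℝ).real (Set.Icc 0 x) = x := by
    rw [Real.volume_real_Icc_of_le hx.1, sub_zero]
  -- `∫₀ˣ |m_T - m_S| ≤ δ x`
  have hI : ∫ v in Set.Icc 0 x, |T.mass v - S.mass v| ≤ δ * x := by
    calc ∫ v in Set.Icc 0 x, |T.mass v - S.mass v|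
        ≤ ‖∫ v in Set.Icc 0 x, |T.mass v - S.mass v|‖ := Real.le_norm_self _
      _ ≤ δ * (volume : Measure ℝ).real (Set.Icc 0 x) :=
          norm_setIntegral_le_of_norm_le_const measure_Icc_lt_top (fun v hv => by
            rw [Real.norm_eq_abs, abs_abs]; exact hmass v hv)
      _ = δ * x := by rw [hvol]
  -- the error term is uniformly small on `[0, x]`
  have hE : ∀ u ∈ Set.Icc 0 x,
      ‖(∫ v in Set.Icc 0 u, S.phi (-(s : ℂ)) v ∂T.massMeasure) -
          (∫ v in Set.Icc 0 u, S.phi (-(s : ℂ)) v ∂S.massMeasure)‖ ≤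
        (S.phi (-(s : ℂ)) x).re * δ +
          s * ((S.phi (-(s : ℂ)) x).re * S.mass x) * (δ * x) := by
    intro u hu
    refine (KreinString.norm_setIntegral_phi_sub_le T S hs hx hxT hu).trans ?_
    have h1 : (S.phi (-(s : ℂ)) x).re * |T.mass u - S.mass u| ≤ (S.phi (-(s : ℂ)) x).re * δ :=
      mul_le_mul_of_nonneg_left (hmass u hu) hC0
    have h2 : s * ((S.phi (-(s : ℂ)) x).re * S.mass x) *
        ∫ v in Set.Icc 0 x, |T.mass v - S.mass v| ≤
        s * ((S.phi (-(s : ℂ)) x).re * S.mass x) * (δ * x) :=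
      mul_le_mul_of_nonneg_left hI (mul_nonneg hs.le (mul_nonneg hC0 (S.mass_nonneg x)))
    linarith
  have hEI : ∫ u in Set.Icc 0 x,
      ‖(∫ v in Set.Icc 0 u, S.phi (-(s : ℂ)) v ∂T.massMeasure) -
          (∫ v in Set.Icc 0 u, S.phi (-(s : ℂ)) v ∂S.massMeasure)‖ ≤
        ((S.phi (-(s : ℂ)) x).re * δ +
          s * ((S.phi (-(s : ℂ)) x).re * S.mass x) * (δ * x)) * x := by
    calc ∫ u in Set.Icc 0 x, ‖(∫ v in Set.Icc 0 u, S.phi (-(s : ℂ)) v ∂T.massMeasure) -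
            (∫ v in Set.Icc 0 u, S.phi (-(s : ℂ)) v ∂S.massMeasure)‖
        ≤ ‖∫ u in Set.Icc 0 x, ‖(∫ v in Set.Icc 0 u, S.phi (-(s : ℂ)) v ∂T.massMeasure) -
            (∫ v in Set.Icc 0 u, S.phi (-(s : ℂ)) v ∂S.massMeasure)‖‖ := Real.le_norm_self _
      _ ≤ ((S.phi (-(s : ℂ)) x).re * δ +
            s * ((S.phi (-(s : ℂ)) x).re * S.mass x) * (δ * x)) *
            (volume : Measure ℝ).real (Set.Icc 0 x) :=
          norm_setIntegral_le_of_norm_le_const measure_Icc_lt_top (fun u hu => by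
            rw [norm_norm]; exact hE u hu)
      _ = _ := by rw [hvol]
  refine (KreinString.norm_phi_neg_sub_le T S hs hx hxT ⟨hx.1, le_rfl⟩).trans ?_
  exact mul_le_mul_of_nonneg_right (mul_le_mul_of_nonneg_left hEI hs.le) hT0

/-! ### The stub -/

/-- **Stub stepApprox — lower step approximation of a monotone-density string.** If `S` has
finite length `L` and mass measure `ρ(y) dy` on `(-∞, L)` with `ρ` measurable, non-decreasing on
`(-∞, L)` and zero on `(-∞, 0)`, then for every interior point `x`, tolerance `ε > 0` and radius `R`
there are step data (`0 ≤ s_0 < … < s_{N-1} ≤ x`, `d_j > 0`) such that every step string `T` with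
that density lies BELOW `S` on `(-∞, x]` and `|φ_T(x, z) - φ_S(x, z)| ≤ ε` for `|z| ≤ R`. -/
theorem stub_stepApprox : ∀ (S : KreinString) (L : ℝ) (ρ : ℝ → ℝ), 0 < L → Measurable ρ →
    MonotoneOn ρ (Set.Iio L) → (∀ y < 0, ρ y = 0) → S.length = ENNReal.ofReal L →
    S.massMeasure = (volume.withDensity fun y => ENNReal.ofReal (ρ y)).restrict (Set.Iio L) →
    ∀ x ∈ S.dom, ∀ ε : ℝ, 0 < ε → ∀ R : ℝ,
    ∃ (N : ℕ) (s d : Fin N → ℝ), StrictMono s ∧ (∀ j, 0 ≤ s j) ∧ (∀ j, s j ≤ x) ∧ (∀ j, 0 < d j) ∧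
      ∀ T : KreinString, T.length = ⊤ →
        T.massMeasure = volume.withDensity
          (fun y => ENNReal.ofReal (∑ j : Fin N, (Set.Ici (s j)).indicator (fun _ => d j) y)) →
        T.massMeasure.restrict (Set.Iic x) ≤ S.massMeasure.restrict (Set.Iic x) ∧
          ∀ z : ℂ, ‖z‖ ≤ R → ‖T.phi z x - S.phi z x‖ ≤ ε := by
  intro S L ρ hL _hρm hmono hρ0 hSL hSμ x hx ε hε R
  have hxL : x < L := (ENNReal.ofReal_lt_ofReal_iff hL).1 (hSL ▸ hx.2)
  -- constants: radius `R' = max R 1 > 0`, `C = φ_S(x, -R')`, `m = m_S(x)`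
  obtain ⟨R', hR'⟩ : ∃ R' : ℝ, R' = max R 1 := ⟨_, rfl⟩
  have hRR' : R ≤ R' := hR' ▸ le_max_left R 1
  have hR'0 : 0 < R' := hR' ▸ lt_of_lt_of_le one_pos (le_max_right R 1)
  obtain ⟨C, hC⟩ : ∃ C : ℝ, C = (S.phi (-(R' : ℂ)) x).re := ⟨_, rfl⟩
  have hC1 : 1 ≤ C := hC ▸ S.one_le_phi_neg_re hR'0.le hx
  have hC0 : 0 ≤ C := zero_le_one.trans hC1
  have hm : 0 ≤ S.mass x := S.mass_nonneg x
  obtain ⟨K, hK⟩ : ∃ K : ℝ, K = R' * ((C + R' * (C * S.mass x) * x) * x) * C := ⟨_, rfl⟩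
  have hK0 : 0 ≤ K := by rw [hK]; have := hx.1; positivity
  obtain ⟨δ, hδ⟩ : ∃ δ : ℝ, δ = ε / (K + 1) := ⟨_, rfl⟩
  have hδ0 : 0 < δ := by rw [hδ]; positivity
  have hKδ : K * δ ≤ ε := by
    rw [hδ, mul_div_assoc', div_le_iff₀ (by positivity)]
    nlinarith
  obtain ⟨N, s, d, hsm, hs0, hsx, hd, hgρ, hlint⟩ :=
    stub_stepApprox_grid ρ L x δ hmono hρ0 hx.1 hxL hδ0
  refine ⟨N, s, d, hsm, hs0, hsx, hd, fun T hTL hTμ => ?_⟩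
  have hgm : Measurable (fun y => ∑ j : Fin N, (Set.Ici (s j)).indicator (fun _ => d j) y) :=
    Finset.measurable_sum _ (fun j _ => measurable_const.indicator measurableSet_Ici)
  have hg0 : ∀ y, 0 ≤ ∑ j : Fin N, (Set.Ici (s j)).indicator (fun _ => d j) y := fun y =>
    Finset.sum_nonneg (fun j _ => Set.indicator_nonneg (fun _ _ => (hd j).le) _)
  have hxT : x ∈ T.dom := ⟨hx.1, by rw [hTL]; exact ENNReal.ofReal_lt_top⟩
  have hdec := stepApprox_decomp S T hxL hgm hSμ hTμ hg0 hgρ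
  have hdom : T.massMeasure.restrict (Set.Iic x) ≤ S.massMeasure.restrict (Set.Iic x) := by
    rw [hdec]
    exact Measure.le_add_right le_rfl
  refine ⟨hdom, fun z hz => ?_⟩
  have hmass : ∀ v ∈ Set.Icc 0 x, |T.mass v - S.mass v| ≤ δ := fun v hv =>
    stepApprox_mass_sub S T hdec hlint hδ0.le hxT hv.2
  have h1 := stepApprox_norm_phi_sub_le S T hx hxT hdom z (hz.trans hRR')
  have h2 := stepApprox_phi_neg_sub_le S T hR'0 hx hxT hmass
  have h3 : (T.phi (-(R' : ℂ)) x).re ≤ C := by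
    have h := stepApprox_norm_phi_sub_le S T hx hxT hdom (-(R' : ℂ))
      (by rw [norm_neg, Complex.norm_real, Real.norm_eq_abs, abs_of_pos hR'0])
    rw [← hC] at h
    linarith [norm_nonneg (T.phi (-(R' : ℂ)) x - S.phi (-(R' : ℂ)) x)]
  have hT0 : 0 ≤ (T.phi (-(R' : ℂ)) x).re := zero_le_one.trans (T.one_le_phi_neg_re hR'0.le hxT)
  have hre : C - (T.phi (-(R' : ℂ)) x).re ≤ ‖T.phi (-(R' : ℂ)) x - S.phi (-(R' : ℂ)) x‖ := by
    rw [norm_sub_rev, hC]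
    have h := Complex.re_le_norm (S.phi (-(R' : ℂ)) x - T.phi (-(R' : ℂ)) x)
    rwa [Complex.sub_re] at h
  rw [← hC] at h1 h2
  calc ‖T.phi z x - S.phi z x‖ ≤ C - (T.phi (-(R' : ℂ)) x).re := h1
    _ ≤ ‖T.phi (-(R' : ℂ)) x - S.phi (-(R' : ℂ)) x‖ := hre
    _ ≤ R' * ((C * δ + R' * (C * S.mass x) * (δ * x)) * x) * (T.phi (-(R' : ℂ)) x).re := h2
    _ ≤ R' * ((C * δ + R' * (C * S.mass x) * (δ * x)) * x) * C := by
        have := hx.1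
        exact mul_le_mul_of_nonneg_left h3 (by positivity)
    _ = K * δ := by rw [hK]; ring
    _ ≤ ε := hKδ

end Summit.RiemannHypothesis.RiemannHypothesis.Theorems.LeeYangTelegraphString

end
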